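import Summits.ResolutionOfSingularities.ResolutionOfSingularities.Theorems.SatelliteTransport
import HarnessLib

/-!
# SatelliteTransport2 — decomp-res node «SatelliteCut» (lens-4 g28, critic row 164), tree file 3/5 of the node

Content VERBATIM from the decomp-res lens-4 g28 node `HOME/decomp-res-lens-4/g28/SatelliteCut.lean` (pin b83bf2f8 =
`parts/SatelliteCut-g28-b83bf2f8.lean`,
998 l; HOME = run/shared/lean/pub/decomp-res): ONE NEW PART §74–§77 = `parts/part_new-g28-3bc4b3a5.lean` (46
declarations), typed against the LANDED
tree (the node imports `Theorems/DepthCutCells` + `Theorems/MaxContactCutCompanionCut` only; nothing carried, nothing inlined).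
Critic: CRITIC-LEDGER row 164 (2026-08-31T01:23:24Z): CLEARED — DECIDED +1 · MAP 0 (the SATELLITE NO-JUMP LAW over
two consecutive blow-ups =
Hauser's kangaroo condition (3) in kernel, unconditional in the shallow prime-weight window; typed sub-cell `n.Prime
∧ SatelliteJumpTower n` of
`NoWildShallowCompanionKangarooTowers` EMPTY for every `n`; EXACT hypothesis-free re-location to
`NoWildFreeJumpShallowCompanionKangarooTowers`; entrances
on both sides; census cross-check T-satellite (census-1 g23, `HOME/census/it/kangsat/T-satellite.md` 2d03875b)
confirmed 2/2 · 33/33 · 0/88).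
Landing orders INBOX :651 (lens-4 g28 landing note, split per NEXT-g29 §3) and :659 (critic): `--kind proof
--supports stmt-ResolutionOfSingularities-28338`,
namespace `…Theorems.HugValuationCut`, canonical headers, one file per section (D-0064); files of the node:
`SatelliteAlgebra` (§74) · `SatelliteTransport` + `SatelliteTransport2` (§75) ·
`SatelliteCutCells` (§76–§77, cone-free cells: the aside home) · `MaxContactCutSatelliteCut` (the four §77
corollaries GIVEN 31571 `MaxContactCut.NoContactHuggingTowers`
BY NAME — in the Theses cone, kept apart so that the route file can import the aside home without an import cycle,
as for `DepthCutCells` / `MaxContactCutDepthCut`).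
Aside bookkeeping (row 164 / INBOX :659): ONE successor aside on the lens-4 column,
`NoWildFreeJumpShallowCompanionKangarooTowers` (home `SatelliteCutCells`),
SUPERSEDING g27's `NoWildShallowCompanionKangarooTowers` (exact hyp-free
`noWildShallowCompanionKangarooTowers_iff_g28`); the decided cell
`NoWildSatelliteJumpShallowTowers` is a THEOREM (`noWildSatelliteJumpShallowTowers_holds`) and is not filed.  TWO
TEXT FIXES at landing (docstrings only, ordered by
the critic, row 164 / INBOX :659; no statement or proof changed): (i) the hand inhabitant in the docstring of
`WildFreeJumpShallowCompanionKangarooTowersTerminate`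
is NODE-g28's isolated chain `Z² + U³ + U²T + T⁵ → z² + u²t + u³t + t³ → (z₁ + t)² + tv² + vt² + v²t² + v³t²` (the
lens text named a non-isolated polynomial);
(ii) the part's declaration count «42» → 46.

## This file

§75 second part (NEW, KERNEL): the two transport theorems over ONE point blow-up each — S1
**`eTail_point_transport`** (blow-up of a regular locally Noetherian `X` in the closed point, `C` regular with
support `{π y}`, `𝓘 ≤ 𝔪^n`, `𝓘′ ≤ 𝔪^n`, `PWInv` at `π y`, `WInv` at `y` along `H′` ⟹ `ETail` at `y` along `(H′, E =
C.comap π)`: the transported `w₀ = π^*f/t^n` has tail `t·b`, principality transports to `𝓘′_y ≤ (w₀) + (t^n)`, the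
no-jump witness is `f₁ = e·w₀ + h·t^n` and LEMMA Z forces `e` to be a unit — RE-WITNESSING) and S2
**`wInv_of_eTail_satellite`** (`ETail` at `π y` along `(H, E)`, weight `p = char 𝒪_y`, `y ∈ supp strictTransform E`
(SATELLITE), `𝓘′_y ≤ ⟨h^p : h ∈ S⟩ + 𝔪^{p+1}` ⟹ `WInv` at `y` along `H′`: two point rounds, tail′ = `s′·t₁·g₁` with
`(s′, t₁)` JOINT regular parameters because `t₁ ∈ 𝔪_y` is the satellite incidence, then LEMMA D).  Same `section
SatelliteTransport` header (universe `uT`, the scheme variables) replayed.  Imports `SatelliteTransport`.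

[WRITER NOTE (decomp-res writer g10): file split only (tree files ≤ 400 lines); namespace, universes, sections,
section variables and every declaration
exactly as in the lens (the node's global `set_option` and the `open …Theses` line live only in the wiring file; the
pure-algebra file opens only what it uses).]

(Sources: Hauser2010Kangaroo (arXiv:0811.4151 p. 6, Kangaroo Theorem condition (3) + remark (a)); HauserPerlega2019
§2; Hauser2024 PRIMS 60; Moh1987; Matsumura1987 Thms. 14.2–14.3; ZariskiSamuel1960 VIII §11; StacksProject Tag 00NQ;
CossartPiltant2008 §2; Giraud1975.)
-/

noncomputable section

open CategoryTheory AlgebraicGeometry IsLocalRing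
open Literature.AlgebraicGeometry.Resolution
open Summit.ResolutionOfSingularities.ResolutionOfSingularities.Theorems
open WeakOrderReduction ForcedTowerClasses DivergentTowerClasses MonomialTowerClasses
open HugDimensionClasses HugDimensionKernels SurfaceShadowClasses SurfaceShadowKernels
open NearPointCut (SingularClass)
open AbsoluteContactClasses (IsAbsContactAt SepResidueAt diffIdeal_restrict_le stalkMap_comp_toStalk_eq_stalkHom)
open scoped BigOperators

namespace Summit.ResolutionOfSingularities.ResolutionOfSingularities.Theorems.HugValuationCut

section SatelliteTransport

universe uT
variable {X X' : Scheme.{uT}} {π : X' ⟶ X} {C : X.IdealSheafData}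

/-- **THE PRINCIPAL TRANSPORT WITH MEMORY (KERNEL, PROVED), one point blow-up.**  `π` the blowing up of the regular locally
Noetherian `X` in the closed point `x = π y`, `𝓘_x ⊆ 𝔪_x^n`, `𝓘' = (π^{-1}𝓘 : E^n)` with `𝓘'_y ⊆ 𝔪_y^n` (the order did
not drop), `PWInv 𝓘 H n x` (principal weak contact along `H`), and NO JUMP at `y`: `WInv 𝓘' H' n y` along the strict transform.
THEN `ETail 𝓘' H' E n y`: the exceptional parameter `t` (`E_y = (t)`) and the transported `z'` (`π^*z = t z'`) are JOINTLY
regular parameters (`point_round_chart_rsop`), and some `w₁ ∈ 𝓘'_y`, `c'` a unit, have `w₁ − c'·z'^n ∈ (t) ∩ 𝔪_y^{n+1}`.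
RE-WITNESSING: the transported `w₀ = π^*f/t^n` has tail `t·b`; principality `𝓘'_y ⊆ (w₀) + (t^n)` (transported from
`𝓘_x ⊆ (f) + 𝔪_x^{2n}`) writes the no-jump witness as `f₁ = e·w₀ + h·t^n`; LEMMA Z (`(t, z')` rsop: a unit multiple of
`z'^n` is never in `(t) + 𝔪^{n+1}`) forces `e` to be a unit and the unit to agree with `c'` modulo `𝔪`, so `w₁ = e⁻¹f₁`
works.  (Sources: Hauser2010Kangaroo; EncinasVillamayor2000, Thm. 4.9; StacksProject, Tag 0BIQ; Matsumura1987, Thm. 14.3.) -/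
theorem eTail_point_transport (hπ : IsBlowup π C) [IsLocallyNoetherian X] [IsLocallyNoetherian X']
    (hX : Scheme.IsRegular X) (hCreg : Scheme.IsRegular C.subscheme) (I H : X.IdealSheafData) {n : ℕ} (hn : 1 ≤ n)
    (y : X') (hcl : IsClosed ({π y} : Set X)) (hpt : (C.support : Set X) = {π y})
    (hIn : stalkIdeal I (π y) ≤ maximalIdeal _ ^ n)
    (hI'n : stalkIdeal (controlledTransform π C I n) y ≤ maximalIdeal _ ^ n)
    (h : PWInv I H n (π y)) (h' : WInv (controlledTransform π C I n) (strictTransformIdeal π C H) n y) :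
    ETail (controlledTransform π C I n) (strictTransformIdeal π C H) (C.comap π) n y := by
  obtain ⟨z, hHz, hz1, hz2, f, hfI, hpr, c, hc, hfz⟩ := h
  haveI : IsRegularLocalRing (X.presheaf.stalk (π y)) := hX _
  have hCst : stalkIdeal C (π y) = maximalIdeal _ := by
    rw [eq_vanishingIdeal_support_of_isRegular C hCreg]
    apply stalkIdeal_vanishingIdeal_eq_maximalIdeal_of_closure_eq
    rw [hpt, hcl.closure_eq]
  obtain ⟨𝔷, z', hE, hnzd, hzz', -, hreg⟩ := point_round_chart_rsop hπ y hCst hz1 hz2 hHz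
  set σ := (π.stalkMap y).hom with hσ
  set t := σ 𝔷 with ht
  have hEm : (maximalIdeal (X.presheaf.stalk (π y))).map σ = Ideal.span {t} := by
    rw [← hCst, ← stalkIdeal_comap_eq_map_stalkMap, hE]
  -- `π^* f = w₀ · t^n` with `w₀ ∈ 𝓘'_y`
  have hσf : σ f ∈ Ideal.span {t ^ n} := by
    have hm : σ f ∈ (maximalIdeal _ ^ n).map σ := Ideal.mem_map_of_mem _ (hIn hfI)
    rwa [Ideal.map_pow, hEm, Ideal.span_singleton_pow] at hm
  obtain ⟨w₀, hw₀⟩ := Ideal.mem_span_singleton'.mp hσf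
  have hI' : stalkIdeal (controlledTransform π C I n) y =
      Submodule.colon ((stalkIdeal I (π y)).map σ) {t ^ n} := by
    rw [hπ.stalkIdeal_controlledTransform I n y, stalkIdeal_comap_eq_map_stalkMap, hE,
      Ideal.span_singleton_pow, Submodule.colon_span]
  have hw₀I' : w₀ ∈ stalkIdeal (controlledTransform π C I n) y := by
    rw [hI', Submodule.mem_colon_singleton, smul_eq_mul, hw₀]
    exact Ideal.mem_map_of_mem _ hfI
  -- `π^*(f − c z^n) = b · t^{n+1}`
  have hσr : σ (f - c * z ^ n) ∈ Ideal.span {t ^ (n + 1)} := by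
    have hm : σ (f - c * z ^ n) ∈ (maximalIdeal _ ^ (n + 1)).map σ := Ideal.mem_map_of_mem _ hfz
    rwa [Ideal.map_pow, hEm, Ideal.span_singleton_pow] at hm
  obtain ⟨b, hb⟩ := Ideal.mem_span_singleton'.mp hσr
  have hkey : w₀ - σ c * z' ^ n = t * b := by
    have h1 : t ^ n * (w₀ - σ c * z' ^ n) = t ^ n * (t * b) := by
      have e1 : σ (f - c * z ^ n) = σ f - σ c * (t * z') ^ n := by rw [map_sub, map_mul, map_pow, hzz']
      calc t ^ n * (w₀ - σ c * z' ^ n) = w₀ * t ^ n - σ c * (t * z') ^ n := by ring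
        _ = σ (f - c * z ^ n) := by rw [e1, hw₀]
        _ = b * t ^ (n + 1) := hb.symm
        _ = t ^ n * (t * b) := by ring
    exact (mul_cancel_left_mem_nonZeroDivisors (pow_mem hnzd n)).mp h1
  have htm : t ∈ maximalIdeal (X'.presheaf.stalk y) := by
    have h1 : t ∈ (maximalIdeal (X.presheaf.stalk (π y))).map σ := by
      rw [hEm]; exact Ideal.mem_span_singleton_self t
    have hle : (maximalIdeal (X.presheaf.stalk (π y))).map σ ≤ maximalIdeal (X'.presheaf.stalk y) :=
      Ideal.map_le_iff_le_comap.mpr fun a ha => Ideal.mem_comap.mpr (map_nonunit σ a ha)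
    exact hle h1
  have hcu : IsUnit (σ c) := hc.map σ
  have hI'1 : stalkIdeal (controlledTransform π C I n) y ≤ maximalIdeal _ :=
    hI'n.trans (Ideal.pow_le_self (by omega))
  have hz'n : σ c * z' ^ n ∈ maximalIdeal (X'.presheaf.stalk y) := by
    have h1 : w₀ - t * b ∈ maximalIdeal _ := sub_mem (hI'1 hw₀I') (Ideal.mul_mem_right _ _ htm)
    have e : w₀ - t * b = σ c * z' ^ n := by rw [← hkey]; ring
    rwa [e] at h1
  have hz'm : z' ∈ maximalIdeal (X'.presheaf.stalk y) :=
    Ideal.IsPrime.mem_of_pow_mem inferInstance n ((Ideal.unit_mul_mem_iff_mem _ hcu).mp hz'n)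
  obtain ⟨hz'2, hprime, htz', hrs⟩ := hreg hz'm
  have hH' : stalkIdeal (strictTransformIdeal π C H) y = Ideal.span {z'} :=
    stalk_strictTransform_eq_span H y hHz hE hzz' hprime htz'
  -- transported principality: `𝓘'_y ⊆ (w₀) + (t^n)`
  have hpr' : stalkIdeal (controlledTransform π C I n) y ≤ Ideal.span {w₀} ⊔ Ideal.span {t ^ n} := by
    intro g hg
    rw [hI', Submodule.mem_colon_singleton, smul_eq_mul] at hg
    have h1 : g * t ^ n ∈ (Ideal.span {f} ⊔ maximalIdeal _ ^ (2 * n)).map σ := Ideal.map_mono hpr hg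
    rw [Ideal.map_sup, Ideal.map_span, Set.image_singleton, Ideal.map_pow, hEm, Ideal.span_singleton_pow] at h1
    obtain ⟨a₁, ha₁, a₂, ha₂, h12⟩ := Submodule.mem_sup.mp h1
    obtain ⟨α, rfl⟩ := Ideal.mem_span_singleton'.mp ha₁
    obtain ⟨β, rfl⟩ := Ideal.mem_span_singleton'.mp ha₂
    have h2 : t ^ n * g = t ^ n * (α * w₀ + β * t ^ n) := by
      calc t ^ n * g = g * t ^ n := by ring
        _ = α * σ f + β * t ^ (2 * n) := h12.symm
        _ = t ^ n * (α * w₀ + β * t ^ n) := by rw [← hw₀]; ring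
    rw [(mul_cancel_left_mem_nonZeroDivisors (pow_mem hnzd n)).mp h2]
    exact add_mem (Ideal.mem_sup_left (Ideal.mul_mem_left _ _ (Ideal.mem_span_singleton_self _)))
      (Ideal.mem_sup_right (Ideal.mul_mem_left _ _ (Ideal.mem_span_singleton_self _)))
  -- the no-jump witness along `(z')`
  obtain ⟨f₁, hf₁, c₁, hc₁, hf₁z⟩ := shapeAt_of_wInv h' z' hH'
  obtain ⟨a₁, ha₁, a₂, ha₂, h12⟩ := Submodule.mem_sup.mp (hpr' hf₁)
  obtain ⟨e, rfl⟩ := Ideal.mem_span_singleton'.mp ha₁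
  obtain ⟨k₂, rfl⟩ := Ideal.mem_span_singleton'.mp ha₂
  have htn : t ^ n ∈ Ideal.span {t} := by
    rw [show n = (n - 1) + 1 by omega, pow_succ]
    exact Ideal.mul_mem_left _ _ (Ideal.mem_span_singleton_self t)
  have hz'nm : z' ^ n ∈ maximalIdeal _ ^ n := Ideal.pow_mem_pow hz'm n
  -- `e` is a unit (LEMMA Z)
  have heu : IsUnit e := by
    by_contra hne
    have hem : e ∈ maximalIdeal _ := (IsLocalRing.mem_maximalIdeal e).mpr (mem_nonunits_iff.mpr hne)
    have h1 : c₁ * z' ^ n = e * w₀ + k₂ * t ^ n - (f₁ - c₁ * z' ^ n) := by rw [← h12]; ring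
    have h2 : c₁ * z' ^ n ∈ Ideal.span {t} ⊔ maximalIdeal _ ^ (n + 1) := by
      rw [h1]
      refine sub_mem (add_mem (Ideal.mem_sup_right ?_) (Ideal.mem_sup_left (Ideal.mul_mem_left _ _ htn)))
        (Ideal.mem_sup_right hf₁z)
      rw [pow_succ']
      exact Ideal.mul_mem_mul hem (hI'n hw₀I')
    have h3 := mem_maximalIdeal_of_rsopPair hrs h2
    exact ((IsLocalRing.mem_maximalIdeal _).mp h3) hc₁
  obtain ⟨u, hu⟩ := heu
  -- the re-witnessed presentation `w₁ = e⁻¹ f₁ = w₀ + e⁻¹ k₂ t^n`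
  set w₁ : X'.presheaf.stalk y := w₀ + (↑u⁻¹ : X'.presheaf.stalk y) * k₂ * t ^ n with hw₁
  have hw₁f : w₁ = (↑u⁻¹ : X'.presheaf.stalk y) * (e * w₀ + k₂ * t ^ n) := by
    rw [hw₁, ← hu, mul_add, ← mul_assoc, Units.inv_mul, one_mul, mul_assoc]
  have hw₁I : w₁ ∈ stalkIdeal (controlledTransform π C I n) y := by
    rw [hw₁f, h12]; exact Ideal.mul_mem_left _ _ hf₁
  have htail_t : w₁ - σ c * z' ^ n ∈ Ideal.span {t} := by
    have e1 : w₁ - σ c * z' ^ n = t * b + (↑u⁻¹ : X'.presheaf.stalk y) * k₂ * t ^ n := by rw [hw₁, ← hkey]; ring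
    rw [e1]
    exact add_mem (Ideal.mul_mem_right _ _ (Ideal.mem_span_singleton_self t)) (Ideal.mul_mem_left _ _ htn)
  have hδ : ((↑u⁻¹ : X'.presheaf.stalk y) * c₁ - σ c) * z' ^ n ∈ Ideal.span {t} ⊔ maximalIdeal _ ^ (n + 1) := by
    have e1 : ((↑u⁻¹ : X'.presheaf.stalk y) * c₁ - σ c) * z' ^ n =
        (w₁ - σ c * z' ^ n) - (↑u⁻¹ : X'.presheaf.stalk y) * (f₁ - c₁ * z' ^ n) := by
      rw [hw₁f, h12]; ring
    rw [e1]
    exact sub_mem (Ideal.mem_sup_left htail_t) (Ideal.mem_sup_right (Ideal.mul_mem_left _ _ hf₁z))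
  have hδm := mem_maximalIdeal_of_rsopPair hrs hδ
  have htail_m : w₁ - σ c * z' ^ n ∈ maximalIdeal _ ^ (n + 1) := by
    have e1 : w₁ - σ c * z' ^ n = (↑u⁻¹ : X'.presheaf.stalk y) * (f₁ - c₁ * z' ^ n) +
        ((↑u⁻¹ : X'.presheaf.stalk y) * c₁ - σ c) * z' ^ n := by rw [hw₁f, h12]; ring
    rw [e1]
    refine add_mem (Ideal.mul_mem_left _ _ hf₁z) ?_
    rw [pow_succ']
    exact Ideal.mul_mem_mul hδm hz'nm
  exact ⟨z', t, hH', hE, hrs, w₁, hw₁I, σ c, hcu, htail_t, htail_m⟩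

/-- **THE SATELLITE NO-JUMP LAW (KERNEL, PROVED), one point blow-up after an `E`-divisible tail.**  `π` the blowing up of the
regular locally Noetherian `X` in the closed point `x = π y`, `𝓘_x ⊆ 𝔪_x^p`, `𝓘' = (π^{-1}𝓘 : E'^p)`, `𝓘'_y ⊆ 𝔪_y`,
and `ETail 𝓘 H E p x`: weak contact along `H` with tail `t·g ∈ 𝔪_x^{p+1}`, `E_x = (t)`, `(t, z)` regular parameters.
IF `y` IS A SATELLITE POINT — `y` lies on the strict transform of `E` — AND the initial forms of `𝓘'_y` are `p`-POWER FORMS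
(`𝓘'_y ⊆ ⟨h^p : h ∈ S⟩ + 𝔪_y^{p+1}`, `S ⊆ 𝔪_y`, `char 𝒪_y = p`), THEN THERE IS NO JUMP AT `y`: `WInv 𝓘' H' p y`.
PROOF: two point rounds (`π^*z = s z₁`, `π^*t = s' t₁`, `(s) = (s') = E'_y`); the transported tail is
`w₁ − π^*c·z₁^p = s'·t₁·g₁` (cancel `s^p` in `π^*(t·g)`, `π^*g ∈ (s^p)` as `ord g ≥ p`); satellite means `t₁ ∈ 𝔪_y`, so
`(s', t₁)` are JOINT regular parameters (`point_round_chart_rsop` for `E`); LEMMA D: an element of `(s'·t₁)` whose initial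
form is a `p`-power form lies in `𝔪_y^{p+1}`.  In Hauser's letters: at a point of `E_new ∩ E_old'` the transform
`z^p + s^{a'} t₁^{a} g'` has NO monomial `x_j^p` in degree `p`, so no translational move `z ↦ z + γ x_j` is needed — the
kangaroo condition (3) of arXiv:0811.4151 read UNCONDITIONALLY (`a = r_old ∈ [1, p − 1]` is automatic in the shallow window).
(Sources: Hauser2010Kangaroo; HauserPerlega2019 §2; Moh1987; StacksProject, Tag 0BIQ; Matsumura1987, Thm. 14.3.) -/
theorem wInv_of_eTail_satellite (hπ : IsBlowup π C) [IsLocallyNoetherian X] [IsLocallyNoetherian X']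
    (hX : Scheme.IsRegular X) (hCreg : Scheme.IsRegular C.subscheme) (I H E : X.IdealSheafData) {p : ℕ}
    [Fact p.Prime] (y : X') [CharP (X'.presheaf.stalk y) p]
    (hcl : IsClosed ({π y} : Set X)) (hpt : (C.support : Set X) = {π y})
    (hIn : stalkIdeal I (π y) ≤ maximalIdeal _ ^ p)
    (hI'1 : stalkIdeal (controlledTransform π C I p) y ≤ maximalIdeal _)
    (h : ETail I H E p (π y)) (hsat : y ∈ (strictTransformIdeal π C E).support)
    {S : Set (X'.presheaf.stalk y)} (hS : S ⊆ (maximalIdeal (X'.presheaf.stalk y) : Set (X'.presheaf.stalk y)))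
    (hP : stalkIdeal (controlledTransform π C I p) y ≤
      Ideal.span ((fun h : X'.presheaf.stalk y => h ^ p) '' S) ⊔ maximalIdeal _ ^ (p + 1)) :
    WInv (controlledTransform π C I p) (strictTransformIdeal π C H) p y := by
  obtain ⟨z, t, hHz, hEt, hrs0, f, hfI, c, hc, hft, hfm⟩ := h
  haveI : IsRegularLocalRing (X.presheaf.stalk (π y)) := hX _
  have hz1 : z ∈ maximalIdeal _ := by simpa using hrs0.mem_maximalIdeal 1
  have hz2 : z ∉ maximalIdeal _ ^ 2 := by simpa using hrs0.not_mem_sq 1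
  have ht1 : t ∈ maximalIdeal _ := by simpa using hrs0.mem_maximalIdeal 0
  have ht2 : t ∉ maximalIdeal _ ^ 2 := by simpa using hrs0.not_mem_sq 0
  have hCst : stalkIdeal C (π y) = maximalIdeal _ := by
    rw [eq_vanishingIdeal_support_of_isRegular C hCreg]
    apply stalkIdeal_vanishingIdeal_eq_maximalIdeal_of_closure_eq
    rw [hpt, hcl.closure_eq]
  -- the two point rounds
  obtain ⟨𝔷, z₁, hE, hnzd, hzz, -, hreg⟩ := AbsoluteContactClasses.point_round_chart hπ y hCst hz1 hz2 hHz
  obtain ⟨𝔷', t₁, hE', -, htt, -, hreg'⟩ := point_round_chart_rsop hπ y hCst ht1 ht2 hEt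
  set σ := (π.stalkMap y).hom with hσ
  set s := σ 𝔷 with hs
  set s' := σ 𝔷' with hs'
  have hEm : (maximalIdeal (X.presheaf.stalk (π y))).map σ = Ideal.span {s} := by
    rw [← hCst, ← stalkIdeal_comap_eq_map_stalkMap, hE]
  have hmle : (maximalIdeal (X.presheaf.stalk (π y))).map σ ≤ maximalIdeal (X'.presheaf.stalk y) :=
    Ideal.map_le_iff_le_comap.mpr fun a ha => Ideal.mem_comap.mpr (map_nonunit σ a ha)
  have hsm : s ∈ maximalIdeal (X'.presheaf.stalk y) := hmle (by rw [hEm]; exact Ideal.mem_span_singleton_self s)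
  have hs'm : s' ∈ maximalIdeal (X'.presheaf.stalk y) :=
    hmle (by rw [← hCst, ← stalkIdeal_comap_eq_map_stalkMap, hE']; exact Ideal.mem_span_singleton_self s')
  -- `π^* f = w₁ · s^p`, `w₁ ∈ 𝓘'_y`
  have hσf : σ f ∈ Ideal.span {s ^ p} := by
    have hm : σ f ∈ (maximalIdeal _ ^ p).map σ := Ideal.mem_map_of_mem _ (hIn hfI)
    rwa [Ideal.map_pow, hEm, Ideal.span_singleton_pow] at hm
  obtain ⟨w₁, hw₁⟩ := Ideal.mem_span_singleton'.mp hσf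
  have hI' : stalkIdeal (controlledTransform π C I p) y =
      Submodule.colon ((stalkIdeal I (π y)).map σ) {s ^ p} := by
    rw [hπ.stalkIdeal_controlledTransform I p y, stalkIdeal_comap_eq_map_stalkMap, hE,
      Ideal.span_singleton_pow, Submodule.colon_span]
  have hw₁I' : w₁ ∈ stalkIdeal (controlledTransform π C I p) y := by
    rw [hI', Submodule.mem_colon_singleton, smul_eq_mul, hw₁]
    exact Ideal.mem_map_of_mem _ hfI
  -- the tail `t · g` with `g ∈ 𝔪_x^p`
  obtain ⟨g, hg⟩ := Ideal.mem_span_singleton'.mp hft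
  have hgm : g ∈ maximalIdeal _ ^ p := by
    refine mem_pow_of_mul_mem_pow_succ ht2 ?_
    rw [mul_comm, hg]; exact hfm
  have hσg : σ g ∈ Ideal.span {s ^ p} := by
    have hm : σ g ∈ (maximalIdeal _ ^ p).map σ := Ideal.mem_map_of_mem _ hgm
    rwa [Ideal.map_pow, hEm, Ideal.span_singleton_pow] at hm
  obtain ⟨g₁, hg₁⟩ := Ideal.mem_span_singleton'.mp hσg
  -- cancel `s^p`: the new tail is `s' · t₁ · g₁`
  have hkey : w₁ - σ c * z₁ ^ p = s' * t₁ * g₁ := by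
    have h1 : s ^ p * (w₁ - σ c * z₁ ^ p) = s ^ p * (s' * t₁ * g₁) := by
      have e1 : σ (f - c * z ^ p) = σ f - σ c * (s * z₁) ^ p := by rw [map_sub, map_mul, map_pow, hzz]
      have e2 : σ (f - c * z ^ p) = σ g * σ t := by rw [← hg, map_mul]
      calc s ^ p * (w₁ - σ c * z₁ ^ p) = w₁ * s ^ p - σ c * (s * z₁) ^ p := by ring
        _ = σ (f - c * z ^ p) := by rw [e1, hw₁]
        _ = σ g * σ t := e2
        _ = g₁ * s ^ p * (s' * t₁) := by rw [hg₁, htt]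
        _ = s ^ p * (s' * t₁ * g₁) := by ring
    exact (mul_cancel_left_mem_nonZeroDivisors (pow_mem hnzd p)).mp h1
  -- `z₁ ∈ 𝔪_y`
  have hcu : IsUnit (σ c) := hc.map σ
  have hz₁p : σ c * z₁ ^ p ∈ maximalIdeal (X'.presheaf.stalk y) := by
    have h1 : w₁ - s' * t₁ * g₁ ∈ maximalIdeal _ :=
      sub_mem (hI'1 hw₁I') (Ideal.mul_mem_right _ _ (Ideal.mul_mem_right _ _ hs'm))
    have e : w₁ - s' * t₁ * g₁ = σ c * z₁ ^ p := by rw [← hkey]; ring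
    rwa [e] at h1
  have hz₁m : z₁ ∈ maximalIdeal (X'.presheaf.stalk y) :=
    Ideal.IsPrime.mem_of_pow_mem inferInstance p ((Ideal.unit_mul_mem_iff_mem _ hcu).mp hz₁p)
  obtain ⟨hz₁2, hprime, hsz₁⟩ := hreg hz₁m
  have hH' : stalkIdeal (strictTransformIdeal π C H) y = Ideal.span {z₁} :=
    stalk_strictTransform_eq_span H y hHz hE hzz hprime hsz₁
  -- SATELLITE: `t₁ ∈ 𝔪_y`, hence `(s', t₁)` are joint regular parameters
  have ht₁m : t₁ ∈ maximalIdeal (X'.presheaf.stalk y) := by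
    have h1 : t₁ ∈ stalkIdeal (strictTransformIdeal π C E) y :=
      quotient_mem_stalk_strictTransform E y (by rw [hEt]; exact Ideal.mem_span_singleton_self t) hE' htt
    exact ((mem_support_iff_stalkIdeal_le _ _).mp hsat) h1
  obtain ⟨-, -, -, hrs⟩ := hreg' ht₁m
  -- the tail is a `p`-power form modulo `𝔪^{p+1}` …
  have htail : s' * t₁ * g₁ ∈
      Ideal.span ((fun h : X'.presheaf.stalk y => h ^ p) '' (S ∪ {z₁})) ⊔ maximalIdeal _ ^ (p + 1) := by
    have e1 : s' * t₁ * g₁ = w₁ - σ c * z₁ ^ p := hkey.symm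
    rw [e1]
    refine sub_mem ?_ (Ideal.mem_sup_left (Ideal.mul_mem_left _ _ (Ideal.subset_span ⟨z₁, Or.inr rfl, rfl⟩)))
    have hle : Ideal.span ((fun h : X'.presheaf.stalk y => h ^ p) '' S) ⊔ maximalIdeal _ ^ (p + 1) ≤
        Ideal.span ((fun h : X'.presheaf.stalk y => h ^ p) '' (S ∪ {z₁})) ⊔ maximalIdeal _ ^ (p + 1) :=
      sup_le_sup_right (Ideal.span_mono (Set.image_mono Set.subset_union_left)) _
    exact hle (hP hw₁I')
  -- … and divisible by `s'·t₁`: LEMMA D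
  have hS' : S ∪ {z₁} ⊆ (maximalIdeal (X'.presheaf.stalk y) : Set _) :=
    Set.union_subset hS (Set.singleton_subset_iff.mpr hz₁m)
  have hdeep : s' * t₁ * g₁ ∈ maximalIdeal _ ^ (p + 1) := mem_pow_succ_of_rsopPair_pPowerSpan p hrs hS' rfl htail
  refine ⟨z₁, hH', hz₁m, hz₁2, w₁, hw₁I', σ c, hcu, ?_⟩
  rw [hkey]; exact hdeep

end SatelliteTransport

end Summit.ResolutionOfSingularities.ResolutionOfSingularities.Theorems.HugValuationCut
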